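import Summits.ResolutionOfSingularities.ResolutionOfSingularities.Theorems.HilbertSamuelEliminationSigmaMaxModificationsCorridor3WLadderLocalChainsLocal
import HarnessLib

/-!
# [OURS · L1 W4.2] Local near-point chains — the TOWERS: the `e ≡ 1` tail of a chain of point blow-ups of local schemes is an
# infinite fundamental sequence (Cor. 6.37, local form), an `e = ē = 2` chain is a unit-wise localised chain of length-one
# fundamental units (Thm. 6.40); scheme bookkeeping for the (K) KILL ROW of card H `generic-point-descent`
# (crux chain w42 `SigmaMaxModificationsCorridor3` stmt-ResolutionOfSingularities-19249, W4.2 DEAL D6;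
# `--supports stmt-ResolutionOfSingularities-19249`, helper)

OURS (cell res-hironaka, LADDER-RESOLUTION rung L, slot W4.2; seat res-D-pv-046 AS res-L1-s46-pv-9, res-L1-w42-plan-1's W4.2
DEAL 2026-08-27 D6). NOT statements of H. Hironaka's manuscript [Hironaka2017] — nothing of it is used or asserted here; the
inputs are the PRINTED theorems of Cossart–Jannsen–Saito [CossartJannsenSaito2020] as the tree's named facts (statement-only,
taken as hypotheses BY NAME: `Thm314_point_locus`, `Corollary637_char_loc`, `KeyTheorem640_char_localized_isolated`,
`CossartJannsenSaito2020_thm_3_14`) and PROVED tree lemmas (`projDir_line`, res-L1-w42-stub-2's local-step comparison,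
res-L1-w42-lead-1's `inducesIsoOn_singleton_of_isIso_residueFieldMap`, res-type-053's tower localisation). AI-drafted, weaker than
expert review. Sorry-free PROOF file, no definitions.

## Contents (namespace `…SigmaMaxModificationsCorridor3.Moving.LocalChains`)

(§1–§3 — local schemes, one blow-up, transfers — are the companion `…Corridor3WLadderLocalChainsLocal.lean`.)
§4 `exists_localTower_isLocalAt` — res-L1-w42-stub-2's `Moving.exists_localTower` (p506293) re-derived with the extra export
   «stage `0` is LOCAL at `y_0`» demanded by `Corollary637_char_loc`.
§5 `false_of_localTower_grade_one_loc` — res-L1-w42-stub-2's `Moving.false_of_localTower_grade_one` (p509395) adapted to the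
   LOCAL form `Corollary637_char_loc` (binder `ProjDir_line` replaced by the theorem `projDir_line`, (EXC)/(ISO-pt) discharged).
§6 `false_of_units_chain` — an `e = ē = 2` chain of point blow-ups of local schemes, each next stage the local scheme of the
   blow-up at the near point, IS an `IsLocalizedChainOfFundamentalUnits` with all lengths `1` (Def. 6.38 «by convention, a
   fundamental unit of length 1 is `X ← X_1 = Bℓ_x(X)`, `x ← x_1`»; Def. 6.39 read locally, p. 107), which
   `KeyTheorem640_char_localized_isolated` forbids when every initial point is isolated in its Hilbert–Samuel locus.

The consumer is `…Corridor3WLadderLocalChainsTerminate.lean` (`localNearPointChainsTerminate_of_printedFacts`, over res-type-040's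
`…Corridor3WLadderLocalChainsDefs.lean`).

## References

* V. Cossart, U. Jannsen, S. Saito, *Desingularization: Invariants and Strategy*, LNM 2270 (2020): p. 98 Step 9, Def. 3.1 (2),
  Thm. 3.10, Thm. 3.14, Def. 6.34, Cor. 6.37, Def. 6.38, Def. 6.39, Thm. 6.40, p. 107. [CossartJannsenSaito2020]
* U. Görtz, T. Wedhorn, *Algebraic Geometry I* (2nd ed. 2020), Def. 13.90, Prop. 13.91. [GortzWedhorn2020]
* H. Matsumura, *Commutative Ring Theory* (1987), §32. [Matsumura1987]
* The Stacks Project, Tag 01J7. [StacksProject]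
-/

noncomputable section

-- namespace `…Corridor3.Moving` re-enters `…Corridor3` (module convention of the Moving files)
set_option linter.dupNamespace false

open CategoryTheory CategoryTheory.Limits AlgebraicGeometry TopologicalSpace IsLocalRing
open Literature.AlgebraicGeometry.Resolution Literature.RingTheory.HilbertSamuel
open Literature.AlgebraicGeometry.CossartJannsenSaito2020
open Scheme.IdealSheafData

universe u

namespace Summit.ResolutionOfSingularities.ResolutionOfSingularities.Theorems.SigmaMaxModificationsCorridor3.Moving

namespace LocalChains

/-! ## §4 The local tower of a chain of point blow-ups (res-L1-w42-stub-2's `Moving.exists_localTower`, p506293, with the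
extra export `IsLocalAt (T.X 0) (y 0)` needed by the LOCAL form `Corollary637_char_loc`) -/

/-- **THE LOCAL TOWER** — adapted from res-L1-w42-stub-2's `Moving.exists_localTower_spec`
(`…Corridor3WLadderLocalTower.lean`, p506293): from a sequence of blow-ups `π_j : W'_j → W_j` in centres `C_j = 𝓘(V(C_j))`
with `(C_j)_{x_j} = 𝔪_{x_j}`, closed points `x'_j` over `x_j` and links `𝒪_{W'_j,x'_j} ≅ 𝒪_{W_{j+1},x_{j+1}}`, a tower of
blow-ups of closed points over the LOCAL scheme `Spec 𝒪_{W_0,x_0}` whose marked closed points `y_j` have the local rings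
`𝒪_{W_j,x_j}`; the setting transfers to stage `0`, which is LOCAL at `y_0`. [cite: CossartJannsenSaito2020, p. 107, Def. 6.34] -/
theorem exists_localTower_isLocalAt {W W' : ℕ → Scheme.{u}} [hW : ∀ j, IsLocallyNoetherian (W j)]
    (π : ∀ j, W' j ⟶ W j) (C : ∀ j, (W j).IdealSheafData) (hπ : ∀ j, IsBlowup (π j) (C j))
    (hC : ∀ j, C j = vanishingIdeal (C j).support) (x : ∀ j, W j)
    (hx : ∀ j, stalkIdeal (C j) (x j) = maximalIdeal ((W j).presheaf.stalk (x j))) (x' : ∀ j, W' j)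
    (hx' : ∀ j, (π j).base (x' j) = x j) (hcl : ∀ j, IsClosed ({x' j} : Set (W' j)))
    (link : ∀ j, Nonempty ((W' j).presheaf.stalk (x' j) ≅ (W (j + 1)).presheaf.stalk (x (j + 1)))) :
    ∃ (T : BlowupTower.{u}) (y : ∀ j, T.X j),
      (∀ j, T.C j = {y j}) ∧ (∀ j, IsClosed ({y j} : Set (T.X j))) ∧ (∀ j, (T.π j).base (y (j + 1)) = y j) ∧
      (∀ j, Nonempty ((T.X j).presheaf.stalk (y j) ≅ (W j).presheaf.stalk (x j))) ∧
      (∀ N : ℕ, Scheme.IsExcellent (W 0) → topologicalKrullDim (W 0) ≤ (N : WithBot ℕ∞) → KeySetting T N) ∧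
      (CharHypothesis (W 0) (x 0) → CharHypothesis (T.X 0) (y 0)) ∧
      IsLocalAt (T.X 0) (y 0) ∧
      (∀ N : ℕ, IsIsolatedInHSMaxLocus (Spec ((W 0).presheaf.stalk (x 0))) N (closedPoint ((W 0).presheaf.stalk (x 0))) →
        @IsIsolatedInHSMaxLocus (T.X 0) (T.ln 0) N (y 0)) := by
  classical
  -- the state reached after `j` blow-ups: a stage, its marked closed point, and the identification of local rings
  let St : ℕ → Type (u + 1) := fun j =>
    Σ' (Y : Scheme.{u}) (_ : IsLocallyNoetherian Y) (y : Y) (_ : IsClosed ({y} : Set Y)),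
      Y.presheaf.stalk y ≅ (W j).presheaf.stalk (x j)
  -- stage 0: the local scheme of `W_0` at `x_0`
  let st0 : St 0 :=
    ⟨Spec ((W 0).presheaf.stalk (x 0)), inferInstance, closedPoint ((W 0).presheaf.stalk (x 0)),
      isClosed_singleton_of_fromSpecStalk_eq Scheme.fromSpecStalk_closedPoint,
      haveI := isIso_stalkMap_fromSpecStalk (W 0) (x 0) (closedPoint ((W 0).presheaf.stalk (x 0)))
      (asIso (((W 0).fromSpecStalk (x 0)).stalkMap (closedPoint ((W 0).presheaf.stalk (x 0))))).symm ≪≫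
        eqToIso (by rw [Scheme.fromSpecStalk_closedPoint])⟩
  -- the step: blow up the marked point and transport along step `j`
  let stepFn : ∀ j, St j → St (j + 1) := fun j s =>
    haveI : IsLocallyNoetherian s.1 := s.2.1
    haveI : IsLocallyNoetherian (blowup (vanishingIdeal (⟨{s.2.2.1}, s.2.2.2.1⟩ : Closeds s.1))) :=
      CentreSeq.isLocallyNoetherian_blowup _
    let h := exists_localStep_isClosed s.2.2.2.1 (blowup.isBlowup _) (hπ j) (hC j) (hx j) s.2.2.2.2 (hx' j) (hcl j)
    ⟨blowup (vanishingIdeal (⟨{s.2.2.1}, s.2.2.2.1⟩ : Closeds s.1)), inferInstance, h.choose, h.choose_spec.2.1,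
      Classical.choice h.choose_spec.2.2 ≪≫ Classical.choice (link j)⟩
  let st : ∀ j, St j := fun j => Nat.rec (motive := St) st0 (fun j s => stepFn j s) j
  -- the tower
  let T : BlowupTower.{u} :=
    { X := fun j => (st j).1
      ln := fun j => (st j).2.1
      C := fun j => {(st j).2.2.1}
      isClosed_C := fun j => (st j).2.2.2.1
      π := fun j => blowup.π (vanishingIdeal (⟨{(st j).2.2.1}, (st j).2.2.2.1⟩ : Closeds (st j).1))
      isBlowup := fun j => blowup.isBlowup _ }
  refine ⟨T, fun j => (st j).2.2.1, fun j => rfl, fun j => (st j).2.2.2.1, fun j => ?_, fun j => ⟨(st j).2.2.2.2⟩,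
    ?_, ?_, ?_, ?_⟩
  · -- `y_{j+1}` lies over `y_j`: the choice in `stepFn`
    haveI : IsLocallyNoetherian (st j).1 := (st j).2.1
    haveI : IsLocallyNoetherian (blowup (vanishingIdeal (⟨{(st j).2.2.1}, (st j).2.2.2.1⟩ : Closeds (st j).1))) :=
      CentreSeq.isLocallyNoetherian_blowup _
    exact (exists_localStep_isClosed (st j).2.2.2.1 (blowup.isBlowup _) (hπ j) (hC j) (hx j) (st j).2.2.2.2
      (hx' j) (hcl j)).choose_spec.1
  · -- the setting at stage 0: `Spec 𝒪_{W_0,x_0}` via the constant tower on `W_0`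
    intro N hexc hdim
    let T₀ : BlowupTower.{u} :=
      { X := fun _ => W 0, ln := fun _ => hW 0, C := fun _ => ∅, isClosed_C := fun _ => isClosed_empty,
        π := fun _ => 𝟙 (W 0), isBlowup := fun _ => isBlowup_id_vanishingIdeal_empty (W 0) }
    have h := T₀.keySetting_localize (x 0) N ⟨hexc, hdim⟩
    exact ⟨h.excellent, h.dim_le⟩
  · intro hchar
    let T₀ : BlowupTower.{u} :=
      { X := fun _ => W 0, ln := fun _ => hW 0, C := fun _ => ∅, isClosed_C := fun _ => isClosed_empty,
        π := fun _ => 𝟙 (W 0), isBlowup := fun _ => isBlowup_id_vanishingIdeal_empty (W 0) }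
    exact T₀.charHypothesis_localize (x 0) hchar
  · exact isLocalAt_Spec_closedPoint _
  · intro N hiso
    exact hiso

/-! ## §5 Grade one: the local tower of an `e ≡ 1` chain is an infinite fundamental sequence — Cor. 6.37 (local form)
(adapted from res-L1-w42-stub-2's `Moving.false_of_localTower_grade_one`, `…Corridor3WLadderGradeOneUnitsTower.lean` p509395:
`Corollary637_char` ↦ `Corollary637_char_loc` + `IsLocalAt (T.X 0) (y 0)`; the binder `ProjDir_line` is now the THEOREM
`projDir_line` (res-type-064 p509891); (EXC) = `Scheme.IsExcellent.of_locallyOfFiniteType`, (ISO-pt) = res-L1-w42-lead-1's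
`Helpers.inducesIsoOn_singleton_of_isIso_residueFieldMap` p508941) -/

/-- **THE LOCAL TOWER AT GRADE ONE CONTRADICTS COR. 6.37 (LOCAL FORM)** (modulo `Thm314_point_locus` and
`Corollary637_char_loc`): a tower `T` of blow-ups of closed points `y_q` (`T.C q = {y_q}`, `y_{q+1} ↦ y_q`) in the setting
`KeySetting T N`, whose stage `0` is LOCAL at `y_0`, with (F1) and isolation in the Hilbert–Samuel locus at `y_0`, along which
`H^N(y_q) = H^N(y_0)`, `e(y_q) = 1` and the residue characteristic is constant, does not exist: it is a fundamental sequence of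
length `⊤` at `y_0` (Def. 6.34; near locus `= {y_q}` by Thm. 3.14 and the line case of `ℙ(Dir)`), which Cor. 6.37 forbids.
Adapted from res-L1-w42-stub-2's `Moving.false_of_localTower_grade_one` (p509395).
[cite: CossartJannsenSaito2020, Def. 6.34, Thm. 3.14, Cor. 6.37, Thm. 3.10 (1), p. 107] -/
theorem false_of_localTower_grade_one_loc (h314pt : Thm314_point_locus.{u}) (hC637 : Corollary637_char_loc.{u})
    {N : ℕ} (T : BlowupTower.{u}) (y : ∀ j, T.X j) (hC : ∀ j, T.C j = {y j})
    (hycl : ∀ j, IsClosed ({y j} : Set (T.X j))) (hover : ∀ j, (T.π j).base (y (j + 1)) = y j)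
    (hkey : KeySetting T N) (hloc : IsLocalAt (T.X 0) (y 0)) (hchar : CharHypothesis (T.X 0) (y 0))
    (hisol : @IsIsolatedInHSMaxLocus (T.X 0) (T.ln 0) N (y 0))
    (hH : ∀ j, Scheme.hsFun (T.X j) N (y j) = Scheme.hsFun (T.X 0) N (y 0))
    (he : ∀ j, @Scheme.dirDim (T.X j) (T.ln j) (y j) = 1)
    (hp : ∀ j, ringChar (ResidueField ((T.X j).presheaf.stalk (y j))) =
      ringChar (ResidueField ((T.X 0).presheaf.stalk (y 0)))) : False := by
  have hline : ProjDir_line.{u} := projDir_line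
  haveI : ∀ j, IsLocallyNoetherian (T.X j) := T.ln
  -- the centres as `Closeds`
  have hCl : ∀ j, (⟨T.C j, T.isClosed_C j⟩ : Closeds (T.X j)) = ⟨{y j}, hycl j⟩ := fun j => Closeds.ext (hC j)
  have blow : ∀ j, IsBlowup (T.π j) (vanishingIdeal (⟨{y j}, hycl j⟩ : Closeds (T.X j))) := fun j =>
    hCl j ▸ T.isBlowup j
  -- excellence, dimension, (F1) along the tower
  have exc : ∀ j, Scheme.IsExcellent (T.X j) := by
    intro j
    induction j with
    | zero => exact hkey.excellent
    | succ j ih =>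
      haveI := (T.isBlowup j).isProper
      exact Scheme.IsExcellent.of_locallyOfFiniteType (T.π j) ih
  obtain ⟨d₀, hd₀, hchar0⟩ := hchar
  have dim : ∀ j, topologicalKrullDim (T.X j) ≤ (d₀ : WithBot ℕ∞) := by
    intro j
    induction j with
    | zero => exact hd₀.le
    | succ j ih => exact (T.isBlowup j).topologicalKrullDim_le_of_isLocallyNoetherian ih
  have dimN : ∀ j, topologicalKrullDim (T.X j) ≤ (N : WithBot ℕ∞) := by
    intro j
    induction j with
    | zero => exact hkey.dim_le
    | succ j ih => exact (T.isBlowup j).topologicalKrullDim_le_of_isLocallyNoetherian ih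
  have charHyp : ∀ j, CharHypothesis (T.X j) (y j) := by
    intro j
    obtain ⟨d, hd, hdd₀⟩ := exists_topologicalKrullDim_eq (y j) (dim j)
    refine ⟨d, hd, ?_⟩
    rw [hp j]
    rcases hchar0 with h0 | h2
    · exact Or.inl h0
    · exact Or.inr (by omega)
  -- permissible point centres, `H` does not increase
  have perm : ∀ j, IdealSheafData.IsPermissible (vanishingIdeal (⟨{y j}, hycl j⟩ : Closeds (T.X j))) :=
    fun j => isPermissible_singleton_of_one_le_dirDim (hycl j) (he j).symm.le
  have mono : ∀ j (ξ : T.X (j + 1)), Scheme.hsFun (T.X (j + 1)) N ξ ≤ Scheme.hsFun (T.X j) N ((T.π j).base ξ) :=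
    fun j ξ => (blow j).hsFun_le_of_isPermissible (exc j) (perm j) N ξ
  have over_phi : ∀ j, (T.phi j).base (y j) = y 0 := by
    intro j
    induction j with
    | zero => rfl
    | succ j ih => rw [BlowupTower.phi_succ_base, hover, ih]
  have le_of_over : ∀ j (ξ : T.X j), (T.phi j).base ξ = y 0 →
      Scheme.hsFun (T.X j) N ξ ≤ Scheme.hsFun (T.X 0) N (y 0) := by
    intro j
    induction j with
    | zero => intro ξ hξ; exact (congrArg _ hξ).le
    | succ j ih =>
      intro ξ hξ
      rw [BlowupTower.phi_succ_base] at hξ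
      exact (mono j ξ).trans (ih _ hξ)
  -- near points over `y_j` lie on `ℙ(Dir_{y_j})`, which is the single point `y_{j+1}`
  have onDir : ∀ j (ξ : T.X (j + 1)), (T.π j).base ξ = y j →
      Scheme.hsFun (T.X (j + 1)) N ξ = Scheme.hsFun (T.X j) N (y j) → IsOnProjDirectrix (T.π j) ξ :=
    fun j ξ hξ hnear => h314pt (T.X j) (T.X (j + 1)) (T.π j) (y j) (hycl j) N ξ (exc j) (perm j) (blow j)
      (dimN j) hξ (charHyp j) hnear
  have ymem : ∀ j, y (j + 1) ∈ projDirectrixFibre (T.π j) (y j) := fun j =>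
    (mem_projDirectrixFibre _ _ _).mpr ⟨hover j, onDir j (y (j + 1)) (hover j) (by rw [hH (j + 1), hH j])⟩
  have uniq : ∀ j (ξ : T.X (j + 1)), (T.π j).base ξ = y j →
      Scheme.hsFun (T.X (j + 1)) N ξ = Scheme.hsFun (T.X j) N (y j) → ξ = y (j + 1) :=
    fun j ξ hξ hnear => (hline (T.X j) (T.X (j + 1)) (T.π j) (y j) (hycl j) (blow j) (he j)).1
      ((mem_projDirectrixFibre _ _ _).mpr ⟨hξ, onDir j ξ hξ hnear⟩) (ymem j)
  -- the near locus of `y_0` at stage `j` is `{y_j}`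
  have near_iff : ∀ j (ξ : T.X j), ξ ∈ T.nearLocus N (y 0) j ↔ ξ = y j := by
    intro j
    induction j with
    | zero => intro ξ; rw [BlowupTower.nearLocus_zero, Set.mem_singleton_iff]
    | succ j ih =>
      intro ξ
      rw [BlowupTower.mem_nearLocus]
      constructor
      · rintro ⟨hφ, hHξ⟩
        rw [BlowupTower.phi_succ_base] at hφ
        have h1 : Scheme.hsFun (T.X j) N ((T.π j).base ξ) = Scheme.hsFun (T.X 0) N (y 0) :=
          le_antisymm (le_of_over j _ hφ) (hHξ ▸ mono j ξ)
        have h2 : (T.π j).base ξ = y j := (ih _).mp ((BlowupTower.mem_nearLocus _ _ _ _ _).mpr ⟨hφ, h1⟩)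
        exact uniq j ξ h2 (by rw [hHξ, hH j])
      · rintro rfl
        exact ⟨over_phi _, hH _⟩
  -- the fundamental sequence of length `⊤`
  have hdir0 : T.dirDimAt 0 (y 0) = 1 := by rw [BlowupTower.dirDimAt_eq]; exact he 0
  have hFS : IsFundamentalSequence T N (y 0) ⊤ :=
    { one_le_dirDim := hdir0.symm.le
      one_le_length := le_top
      isClosed_point := hycl 0
      centre_zero := hC 0
      centre_one := fun _ => by
        ext ξ
        rw [hC 1, Set.mem_singleton_iff, BlowupTower.projDir]
        constructor
        · rintro rfl; exact ymem 0
        · intro hξ; exact (hline (T.X 0) (T.X 1) (T.π 0) (y 0) (hycl 0) (blow 0) (he 0)).1 hξ (ymem 0)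
      centre_near := fun q _ _ => by
        ext ξ
        rw [hC q, Set.mem_singleton_iff, near_iff]
      permissible := fun q _ => by
        show IdealSheafData.IsPermissible (vanishingIdeal ⟨T.C q, T.isClosed_C q⟩)
        rw [hCl q]; exact perm q
      iso := fun j _ _ =>
        inducesIsoOn_of_eq (T.π j) (hC (j + 1)) (T.isClosed_C (j + 1)) (hycl (j + 1)) (hC j) (T.isClosed_C j)
          (hycl j) (by
            haveI := (hline (T.X j) (T.X (j + 1)) (T.π j) (y j) (hycl j) (blow j) (he j)).2 (y (j + 1)) (ymem j)
            exact Helpers.inducesIsoOn_singleton_of_isIso_residueFieldMap (T.π j) (hycl (j + 1)) (hycl j) (hover j))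
      stop_one := fun h => absurd h (by simp)
      stop_finite := fun j _ h => absurd h (ENat.top_ne_coe _) }
  exact lt_irrefl _ (hC637 T N (y 0) ⊤ hkey hloc ⟨d₀, hd₀, hchar0⟩ hFS hisol hdir0).1




/-! ## §6 Grade two: the chain itself is a unit-wise localised chain of LENGTH-ONE fundamental units — Thm. 6.40 -/

/-- `ē` agrees at the two ends of an isomorphism of local rings. [cite: CossartJannsenSaito2020, Def. 2.26] -/
theorem geomDirDim_eq_of_nonempty_stalkIso {X Y : Scheme.{u}} [IsLocallyNoetherian X] [IsLocallyNoetherian Y] {x : X} {y : Y}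
    (e : Nonempty (X.presheaf.stalk x ≅ Y.presheaf.stalk y)) : Scheme.geomDirDim X x = Scheme.geomDirDim Y y :=
  (geomDirDim_eq_of_ringEquiv e.some.commRingCatIsoToRingEquiv).symm

/-- `e` agrees at the two ends of an isomorphism of local rings. [cite: CossartJannsenSaito2020, Def. 2.26] -/
theorem dirDim_eq_of_nonempty_stalkIso {X Y : Scheme.{u}} [IsLocallyNoetherian X] [IsLocallyNoetherian Y] {x : X} {y : Y}
    (e : Nonempty (X.presheaf.stalk x ≅ Y.presheaf.stalk y)) : Scheme.dirDim X x = Scheme.dirDim Y y :=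
  dirDim_eq_of_stalkIso e.some

/-- **AN `e = ē = 2` CHAIN IS A UNIT-WISE LOCALISED CHAIN OF LENGTH-ONE FUNDAMENTAL UNITS, WHICH THM. 6.40 FORBIDS**
(Def. 6.38 «by convention, a fundamental unit of length 1 is `X ← X_1 = Bℓ_x(X)`, `x ← x_1`»; Def. 6.39 read locally, p. 107:
the next initial stage is the local scheme of `X_1` at `x_1` — exactly the step clause `IsLocalSchemeAt` of the chain).
[cite: CossartJannsenSaito2020, Def. 6.38, Def. 6.39, Thm. 6.40, p. 107] -/
theorem false_of_units_chain (hK640 : KeyTheorem640_char_localized_isolated.{u}) {N : ℕ}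
    (S B : ℕ → Scheme.{u}) [hSln : ∀ i, IsLocallyNoetherian (S i)] [hBln : ∀ i, IsLocallyNoetherian (B i)]
    (π : ∀ i, B i ⟶ S i) (pt : ∀ i, S i) (b : ∀ i, B i)
    (hcl : ∀ i, IsClosed ({pt i} : Set (S i))) (hπ : ∀ i, IsBlowup (π i) (vanishingIdeal ⟨{pt i}, hcl i⟩))
    (hb : ∀ i, (π i).base (b i) = pt i) (hbcl : ∀ i, IsClosed ({b i} : Set (B i)))
    (hH : ∀ i, Scheme.hsFun (B i) N (b i) = Scheme.hsFun (S i) N (pt i))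
    (hS' : ∀ i, IsLocalSchemeAt (S (i + 1)) (pt (i + 1)) (B i) (b i))
    (hloc0 : IsLocalAt (S 0) (pt 0)) (hexc0 : Scheme.IsExcellent (S 0))
    (hdim0 : topologicalKrullDim (S 0) ≤ (N : WithBot ℕ∞)) (hchar0 : CharHypothesis (S 0) (pt 0))
    (hperm : ∀ i, IdealSheafData.IsPermissible (vanishingIdeal (⟨{pt i}, hcl i⟩ : Closeds (S i))))
    (he : ∀ i, Scheme.dirDim (S i) (pt i) = 2) (hē : ∀ i, Scheme.geomDirDim (S i) (pt i) = 2)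
    (heB : ∀ i, Scheme.dirDim (B i) (b i) = 2) (hēB : ∀ i, Scheme.geomDirDim (B i) (b i) = 2)
    (hiso : ∀ i, IsIsolatedInHSMaxLocus (S i) N (pt i)) : False := by
  -- the one-step towers `S_i ← B_i ← B_i ← ⋯` (padding by blow-ups of the empty centre)
  let T : ℕ → BlowupTower.{u} := fun i =>
    { X := fun n => match n with
        | 0 => S i
        | _ + 1 => B i
      ln := fun n => match n with
        | 0 => hSln i
        | _ + 1 => hBln i
      C := fun n => match n with
        | 0 => ({pt i} : Set (S i))
        | _ + 1 => (∅ : Set (B i))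
      isClosed_C := fun n => match n with
        | 0 => hcl i
        | _ + 1 => isClosed_empty
      π := fun n => match n with
        | 0 => π i
        | _ + 1 => 𝟙 (B i)
      isBlowup := fun n => match n with
        | 0 => hπ i
        | _ + 1 => isBlowup_id_vanishingIdeal_empty (B i) }
  have hunit : ∀ i, IsFundamentalUnit (T i) N 1 (pt i) (b i) := fun i =>
    { one_le_length := le_rfl
      isClosed_point := hcl i
      dirDim_eq := he i
      geomDirDim_eq := hē i
      centre_zero := rfl
      centre_one := fun h => absurd h (by norm_num)
      centre_near := fun q hq hq1 => by omega
      permissible := fun q hq => by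
        obtain rfl : q = 0 := by omega
        exact hperm i
      iso := fun j hj hj1 => by omega
      not_surjective := fun j hj hm => by omega
      isClosed_terminal := hbcl i
      terminal_over := by
        show ((T i).phi 1).base (b i) = pt i
        rw [BlowupTower.phi_one]
        exact hb i
      terminal_near := hH i
      terminal_dirDim := heB i
      terminal_geomDirDim := hēB i }
  have hchain : IsLocalizedChainOfFundamentalUnits T N (fun _ => 1) pt b :=
    { isLocalAt_zero := hloc0
      unit := hunit
      link := hS' }
  exact hK640 T N (fun _ => 1) pt b ⟨hexc0, hdim0⟩ hchar0 hchain hiso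

end LocalChains

end Summit.ResolutionOfSingularities.ResolutionOfSingularities.Theorems.SigmaMaxModificationsCorridor3.Moving

end
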